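import Summits.QuantumFields.YangMills.Theses.OnsetSkewLaw
import Summits.QuantumFields.YangMills.Theorems.BalabanLadderInfVolFloorsCore
import Summits.QuantumFields.YangMills.Theorems.BalabanLadderInfVolRPSeries
import Summits.QuantumFields.YangMills.Theorems.LangevinControlUVOSLegsFromFemtoAndGapStubCollar6
import Summits.QuantumFields.YangMills.Theorems.LangevinControlUVOSLegsFromFemtoAndGapStubAssemblyPlaneStrings
import Summits.QuantumFields.YangMills.Theorems.OnsetTautologyOnsetContraction
import Literature.MathematicalPhysics.QuantumFieldTheory.WilsonPlaquetteWeakCouplingFloor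
import Literature.RepresentationTheory.CompactGroups.UnitaryTrick
import HarnessLib

/-!
# Route `OnsetSkewLaw`, crux `RPOnsetFloor` (stmt-QuantumFields-23138) — clause (ii): the RP squares of the atoms
# VANISH at every fixed resolution as `β → ∞`, uniformly over odd-torus limit states

The route thesis lists «RPOnsetFloor(ii) is a separate cheap lemma» and «the uniform plaquette-energy bound behind K3(ii)»
as layer-2 material.  The plaquette bound is in the tree (`Literature/…/WilsonPlaquetteWeakCouplingFloor.lean`,
`wilsonExpectation_plaquette_ge_one_sub_of_weakCoupling`: `⟨(1/N) Re tr U_p⟩ ≥ 1 − η` for `β ≥ β₀(η)`, uniformly in the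
volume, for every compact `G` and unitary `ρ`).  Here we derive clause (ii) of the crux from it, for EVERY compact `G`,
lattice datum `r`, compactly supported profile `b` and level `ε > 0`:

`∀ s₀ > 0 ∃ β₁ ∀ β ≥ β₁ ∀ μ ∈ oddTorusLimitPoints r β ∀ s ≥ s₀ ∀ q ∀ y ∈ [0,s]⁴, rpSq {q} s y < ε`
(`onsetVanishes`, the clause verbatim with the item's `let`s expanded).

Mechanism: (1) `∫ (N − plane q x) dμ ≤ N·η` for odd-torus limit states at `β ≥ β₀(η)` (torus floor, `torusE_plane_eq_wilsonTorusMean`,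
`plaquetteHolonomyZd_torusLift_eq`, `tendsto_torusE`) — `integral_deficit_le`; (2) the centred mixed second moment is
`≤ 2N²η` (`0 ≤ N − plane ≤ 2N`, variance ≤ second moment about `N`) — `abs_stateMomentStr_two_le`; (3) for `s ≥ s₀` and
`y ∈ [0,s]⁴` the atom weights live in ONE finite box (`|xᵢ| ≤ R/s₀ + 3`, tree `abs_coord_le_of_ne_zero`) and are bounded by
`sup |b|`, so `rpSq ≤ 2N²η · (#box · sup|b|)² < ε` for `η` small.

THEOREMS ONLY.  Free-hands width seat `ym-line-sfw-p2-w4` (cell ym-idea-1).  Clause (i) of the crux (the NT wall) is not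
touched; no summit, rung or crux is proved here and nothing about the Yang–Mills mass gap follows.
-/

set_option autoImplicit false

noncomputable section

open scoped BigOperators
open MeasureTheory Filter Topology
open Literature.MathematicalPhysics.QuantumFieldTheory Literature.MathematicalPhysics.QuantumLattice
open Literature.Probability.LatticeModels (Site)
open Summit.QuantumFields.YangMills.Theorems.InfiniteVolume (stateMomentStr tendsto_torusE)
open Summit.QuantumFields.YangMills.Theorems.InfVolRP (centreOffset norm_centreOffset_le_one
  mem_infiniteVolumeLimitPoints_of_mem_oddTorusLimitPoints)
open Summit.QuantumFields.YangMills.Cruxes.OSLegsFromFemtoAndGap.DlrCollarTransfer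
  (plane torusE continuous_plane exists_abs_plane_le isCylinder_plane)
open Summit.QuantumFields.YangMills.Theorems.OSLegsFromFemtoAndGap (torusE_plane_eq_wilsonTorusMean)
open Summit.QuantumFields.YangMills.Theorems.OnsetTautologyOnsetContraction (stateMomentStr_two abs_coord_le_of_ne_zero)

namespace Summit.QuantumFields.YangMills.Theorems.OnsetSkewLawGlue

variable {G : Type} [Group G] [TopologicalSpace G] [IsTopologicalGroup G] [CompactSpace G]
  [MeasurableSpace G] [BorelSpace G]

/-! ## 1. The plaquette deficit in odd-torus limit states -/

omit [BorelSpace G] in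
/-- `plane ≤ N` pointwise (and `≥ −N`): the single-plane field is the real trace of an `N`-dimensional representation
matrix. [folklore] -/
theorem abs_plane_le_N (r : LatticeRep G) (q : Fin 4 × Fin 4) (x : Site 4) (U : LGConfig 4 G) :
    |plane G r q x U| ≤ r.N := by
  unfold plane Literature.MathematicalPhysics.QuantumLattice.plaquetteObs
  have h := Literature.RepresentationTheory.CompactGroups.CompactGroup.abs_re_trace_le_card r.ρ r.continuous
    (plaquetteHolonomyZd (configShift (-x) U) 0 q.1 q.2)
  simpa using h

/-- The torus mean of a single-plane field is the Wilson expectation of a plaquette trace on the torus. [folklore] -/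
theorem torusE_plane_eq (r : LatticeRep G) (β : ℝ) (L : ℕ) (q : Fin 4 × Fin 4) (x : Site 4) :
    torusE G r β L (plane G r q x) =
      wilsonExpectation (L := 2 * L + 1) r.ρ β (fun U : GaugeConfig 4 (2 * L + 1) G =>
        (r.ρ (plaquetteHolonomy U (Literature.Probability.LatticeModels.Torus.proj (2 * L + 1) 0) q.1 q.2)).trace.re) := by
  rw [torusE_plane_eq_wilsonTorusMean]
  unfold wilsonTorusMean wilsonExpectation Literature.MathematicalPhysics.QuantumLattice.plaquetteObs
  refine integral_congr_ae (Eventually.of_forall fun U => ?_)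
  exact congrArg (fun g => (r.ρ g).trace.re) (plaquette_torusLift (2 * L + 1) U 0 q.1 q.2)

/-- **Plaquette deficit in odd-torus limit states.**  For every `η > 0` there is `β₀` such that for `β ≥ β₀`, every
odd-torus limit state `μ`, every orientation `q.1 < q.2` and site `x`: `∫ (N − plane q x) dμ ≤ N·η`. [folklore] -/
theorem integral_deficit_le (r : LatticeRep G) {η : ℝ} (hη : 0 < η) :
    ∃ β₀ : ℝ, ∀ β : ℝ, β₀ ≤ β → ∀ μ ∈ oddTorusLimitPoints r β, ∀ (q : Fin 4 × Fin 4), q.1 < q.2 → ∀ x : Site 4,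
      ∫ U, ((r.N : ℝ) - plane G r q x U) ∂μ ≤ r.N * η := by
  haveI : SecondCountableTopology G := r.secondCountableTopology
  haveI : T2Space G := r.t2Space
  by_cases hN : r.N = 0
  · -- degenerate: `plane ≡ 0 = N`
    refine ⟨0, fun β _ μ hμ q _ x => ?_⟩
    have hμ' := mem_infiniteVolumeLimitPoints_of_mem_oddTorusLimitPoints r hμ
    obtain ⟨-, -, hprob, -⟩ := id hμ'
    have h0 : ∀ U, ((r.N : ℝ) - plane G r q x U) = 0 := by
      intro U
      have h := abs_plane_le_N r q x U
      rw [hN, Nat.cast_zero, abs_nonpos_iff] at h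
      rw [h, hN, Nat.cast_zero, sub_zero]
    have hfun : (fun U => ((r.N : ℝ) - plane G r q x U)) = fun _ => (0 : ℝ) := funext h0
    rw [hfun, integral_const, smul_zero]
    positivity
  · have hN1 : 1 ≤ r.N := Nat.one_le_iff_ne_zero.mpr hN
    obtain ⟨β₀, _, hβ₀⟩ := wilsonExpectation_plaquette_ge_one_sub_of_weakCoupling (d := 4) (G := G) r.ρ
      (by norm_num) hN1 r.continuous r.mem_unitary hη
    refine ⟨β₀, fun β hβ μ hμ q hq x => ?_⟩
    have hμ' := mem_infiniteVolumeLimitPoints_of_mem_oddTorusLimitPoints r hμ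
    obtain ⟨-, -, hprob, -⟩ := id hμ'
    obtain ⟨S, hS, hlim⟩ := hμ
    obtain ⟨C, hC⟩ := exists_abs_plane_le (G := G) r
    -- torus side: every torus mean of the plane field is `≥ N (1 − η)`
    have htorus : ∀ k, (r.N : ℝ) * (1 - η) ≤ torusE G r β (S k) (plane G r q x) := by
      intro k
      haveI : NeZero (2 * S k + 1) := ⟨by omega⟩
      have h := hβ₀ β hβ (2 * S k + 1) (Literature.Probability.LatticeModels.Torus.proj (2 * S k + 1) 0) q.1 q.2
        (ne_of_lt hq)
      rw [torusE_plane_eq]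
      have hN0 : (0 : ℝ) < r.N := by exact_mod_cast hN1
      have hlin : wilsonExpectation (L := 2 * S k + 1) r.ρ β (fun U : GaugeConfig 4 (2 * S k + 1) G =>
          (r.ρ (plaquetteHolonomy U (Literature.Probability.LatticeModels.Torus.proj (2 * S k + 1) 0) q.1 q.2)).trace.re) =
          r.N * wilsonExpectation (L := 2 * S k + 1) r.ρ β (fun U : GaugeConfig 4 (2 * S k + 1) G =>
            ((r.N : ℝ))⁻¹ * (r.ρ (plaquetteHolonomy U (Literature.Probability.LatticeModels.Torus.proj (2 * S k + 1) 0)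
              q.1 q.2)).trace.re) := by
        unfold wilsonExpectation
        rw [integral_const_mul, ← mul_assoc, mul_inv_cancel₀ hN0.ne', one_mul]
      rw [hlin]
      exact mul_le_mul_of_nonneg_left h hN0.le
    -- limit
    have hlimit : (r.N : ℝ) * (1 - η) ≤ ∫ U, plane G r q x U ∂μ :=
      ge_of_tendsto' (tendsto_torusE r hlim (isCylinder_plane r q x) (continuous_plane r q x) ⟨C, hC q x⟩) htorus
    have hint : Integrable (plane G r q x) μ :=
      Integrable.of_bound (continuous_plane r q x).measurable.aestronglyMeasurable C
        (Eventually.of_forall fun U => by rw [Real.norm_eq_abs]; exact hC q x U)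
    rw [integral_sub (integrable_const _) hint, integral_const, probReal_univ, one_smul]
    linarith

/-! ## 2. The centred mixed second moments are small -/

omit [IsTopologicalGroup G] [CompactSpace G] [BorelSpace G] in
/-- In a probability state with `∫ (N − plane) ≤ D` for two plane fields, the centred mixed moment is `≤ 2N·D` in
absolute value (`0 ≤ N − plane ≤ 2N`; variance ≤ second moment about `N`). [folklore] -/
theorem abs_stateMomentStr_two_le (r : LatticeRep G) (μ : Measure (LGConfig 4 G)) [IsProbabilityMeasure μ]
    [SecondCountableTopology G] [IsTopologicalGroup G] [CompactSpace G] [BorelSpace G]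
    (q q' : Fin 4 × Fin 4) (x x' : Site 4) {D : ℝ}
    (hq : ∫ U, ((r.N : ℝ) - plane G r q x U) ∂μ ≤ D) (hq' : ∫ U, ((r.N : ℝ) - plane G r q' x' U) ∂μ ≤ D) :
    |stateMomentStr G r μ 2 ![q, q'] ![x, x']| ≤ 2 * r.N * D := by
  rw [stateMomentStr_two]
  -- notation
  set P : LGConfig 4 G → ℝ := plane G r q x with hP
  set P' : LGConfig 4 G → ℝ := plane G r q' x' with hP'
  have hPN : ∀ U, |P U| ≤ r.N := fun U => abs_plane_le_N r q x U
  have hP'N : ∀ U, |P' U| ≤ r.N := fun U => abs_plane_le_N r q' x' U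
  have hPm : Measurable P := (continuous_plane r q x).measurable
  have hP'm : Measurable P' := (continuous_plane r q' x').measurable
  have hPi : Integrable P μ := Integrable.of_bound hPm.aestronglyMeasurable _
    (Eventually.of_forall fun U => by rw [Real.norm_eq_abs]; exact hPN U)
  have hP'i : Integrable P' μ := Integrable.of_bound hP'm.aestronglyMeasurable _
    (Eventually.of_forall fun U => by rw [Real.norm_eq_abs]; exact hP'N U)
  set a : ℝ := ∫ V, P V ∂μ with ha
  set a' : ℝ := ∫ V, P' V ∂μ with ha'
  -- bounded centred fields
  have hbd : ∀ (f : LGConfig 4 G → ℝ) (c : ℝ), (∀ U, |f U| ≤ r.N) → Measurable f →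
      Integrable (fun U => (f U - c) ^ 2) μ ∧ Integrable (fun U => f U - c) μ := by
    intro f c hf hfm
    have hi : Integrable (fun U => f U - c) μ :=
      (Integrable.of_bound hfm.aestronglyMeasurable _ (Eventually.of_forall fun U => by
        rw [Real.norm_eq_abs]; exact hf U)).sub (integrable_const c)
    refine ⟨?_, hi⟩
    refine Integrable.of_bound ((hfm.sub measurable_const).pow_const 2).aestronglyMeasurable ((r.N + |c|) ^ 2)
      (Eventually.of_forall fun U => ?_)
    rw [Real.norm_eq_abs, abs_pow]
    refine pow_le_pow_left₀ (abs_nonneg _) ?_ 2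
    exact (abs_sub _ _).trans (add_le_add (hf U) le_rfl)
  -- pointwise: |(P−a)(P'−a')| ≤ ((P−a)² + (P'−a')²)/2
  have hpt : ∀ U, |(P U - a) * (P' U - a')| ≤ ((P U - a) ^ 2 + (P' U - a') ^ 2) / 2 := by
    intro U
    rw [abs_mul, ← sq_abs (P U - a), ← sq_abs (P' U - a')]
    nlinarith [sq_nonneg (|P U - a| - |P' U - a'|), abs_nonneg (P U - a), abs_nonneg (P' U - a')]
  -- variance ≤ second moment about `N` ≤ 2N · ∫(N − P)
  have hvar : ∀ (f : LGConfig 4 G → ℝ), (∀ U, |f U| ≤ r.N) → Measurable f →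
      ∫ U, (f U - ∫ V, f V ∂μ) ^ 2 ∂μ ≤ 2 * r.N * ∫ U, ((r.N : ℝ) - f U) ∂μ := by
    intro f hf hfm
    set c : ℝ := ∫ V, f V ∂μ with hc
    obtain ⟨h2c, h1c⟩ := hbd f c hf hfm
    obtain ⟨h2N, h1N⟩ := hbd f r.N hf hfm
    have hfi : Integrable f μ := Integrable.of_bound hfm.aestronglyMeasurable _
      (Eventually.of_forall fun U => by rw [Real.norm_eq_abs]; exact hf U)
    -- ∫ (f − N)² = ∫ (f − c)² + (c − N)²
    have i1 : ∫ U, (f U - c) ∂μ = 0 := by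
      rw [integral_sub hfi (integrable_const c), integral_const, probReal_univ, one_smul, ← hc, sub_self]
    have i3 : ∫ U, (2 * (c - r.N) * (f U - c) + (c - r.N) ^ 2) ∂μ = (c - r.N) ^ 2 := by
      rw [integral_add (h1c.const_mul _) (integrable_const _), integral_const_mul, i1, mul_zero, zero_add,
        integral_const, probReal_univ, one_smul]
    have hlin : Integrable (fun U => 2 * (c - r.N) * (f U - c) + (c - r.N) ^ 2) μ :=
      (h1c.const_mul _).add (integrable_const _)
    have hexp : ∫ U, (f U - r.N) ^ 2 ∂μ = ∫ U, (f U - c) ^ 2 ∂μ + (c - r.N) ^ 2 := by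
      calc ∫ U, (f U - r.N) ^ 2 ∂μ = ∫ U, ((f U - c) ^ 2 + (2 * (c - r.N) * (f U - c) + (c - r.N) ^ 2)) ∂μ :=
            integral_congr_ae (Eventually.of_forall fun U =>
              (show (f U - (r.N : ℝ)) ^ 2 = (f U - c) ^ 2 + (2 * (c - r.N) * (f U - c) + (c - r.N) ^ 2) by ring))
        _ = ∫ U, (f U - c) ^ 2 ∂μ + ∫ U, (2 * (c - r.N) * (f U - c) + (c - r.N) ^ 2) ∂μ := integral_add h2c hlin
        _ = ∫ U, (f U - c) ^ 2 ∂μ + (c - r.N) ^ 2 := by rw [i3]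
    -- (f − N)² ≤ 2N (N − f)
    have hpw : ∀ U, (f U - r.N) ^ 2 ≤ 2 * r.N * ((r.N : ℝ) - f U) := by
      intro U
      have h1 : f U ≤ r.N := (le_abs_self _).trans (hf U)
      have h2 : -(r.N : ℝ) ≤ f U := neg_le_of_abs_le (hf U)
      nlinarith
    have hle : ∫ U, (f U - r.N) ^ 2 ∂μ ≤ ∫ U, 2 * r.N * ((r.N : ℝ) - f U) ∂μ :=
      integral_mono h2N (((integrable_const _).sub hfi).const_mul _) hpw
    rw [integral_const_mul] at hle
    have hsq : 0 ≤ (c - (r.N : ℝ)) ^ 2 := sq_nonneg _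
    linarith
  -- assemble
  obtain ⟨h2P, h1P⟩ := hbd P a hPN hPm
  obtain ⟨h2P', h1P'⟩ := hbd P' a' hP'N hP'm
  have hprod : Integrable (fun U => (P U - a) * (P' U - a')) μ := by
    refine Integrable.of_bound (h1P.aestronglyMeasurable.mul h1P'.aestronglyMeasurable) ((r.N + |a|) * (r.N + |a'|))
      (Eventually.of_forall fun U => ?_)
    rw [Real.norm_eq_abs, abs_mul]
    exact mul_le_mul ((abs_sub _ _).trans (add_le_add (hPN U) le_rfl))
      ((abs_sub _ _).trans (add_le_add (hP'N U) le_rfl)) (abs_nonneg _) (by positivity)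
  calc |∫ U, (P U - a) * (P' U - a') ∂μ| ≤ ∫ U, |(P U - a) * (P' U - a')| ∂μ := by
        have := norm_integral_le_integral_norm (μ := μ) (fun U => (P U - a) * (P' U - a'))
        simpa only [Real.norm_eq_abs] using this
    _ ≤ ∫ U, ((P U - a) ^ 2 + (P' U - a') ^ 2) / 2 ∂μ :=
        integral_mono hprod.abs ((h2P.add h2P').div_const 2) hpt
    _ = ((∫ U, (P U - a) ^ 2 ∂μ) + ∫ U, (P' U - a') ^ 2 ∂μ) / 2 := by
        rw [integral_div, integral_add h2P h2P']
    _ ≤ (2 * r.N * D + 2 * r.N * D) / 2 := by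
        have h1 := (hvar P hPN hPm).trans (mul_le_mul_of_nonneg_left hq (by positivity))
        have h2 := (hvar P' hP'N hP'm).trans (mul_le_mul_of_nonneg_left hq' (by positivity))
        linarith
    _ = 2 * r.N * D := by ring

/-! ## 3. The weights: one box, one bound -/

/-- For `s ≥ s₀ > 0` and offsets in the box `[0, s]⁴`, both atom weights of a compactly supported profile vanish off ONE
finite set of (orientation, site) pairs. [folklore] -/
theorem exists_support_box_unif (b : EuclideanSpace ℝ (Fin 4) → ℝ) (hb : HasCompactSupport b)
    (Q : Finset (Fin 4 × Fin 4)) {s₀ : ℝ} (hs₀ : 0 < s₀) :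
    ∃ S : Finset ((Fin 4 × Fin 4) × Site 4), ∀ (s : ℝ), s₀ ≤ s → ∀ y : EuclideanSpace ℝ (Fin 4),
      (∀ i, 0 ≤ y i ∧ y i ≤ s) → ∀ p : (Fin 4 × Fin 4) × Site 4, p ∉ S →
        (if p.1 ∈ Q ∧ p.1.1 < p.1.2 then b (s • (siteToE p.2 + centreOffset p.1) - y) else 0) = 0 ∧
        (if p.1 ∈ Q ∧ p.1.1 < p.1.2 then b (timeReflection 4 (s • (siteToE p.2 + centreOffset p.1)) - y) else 0) = 0 := by
  obtain ⟨R, hR0, hR⟩ : ∃ R : ℝ, 0 ≤ R ∧ Function.support b ⊆ Metric.closedBall 0 R := by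
    obtain ⟨R, hR⟩ := (hb.isCompact.isBounded).subset_closedBall (0 : EuclideanSpace ℝ (Fin 4))
    refine ⟨max R 0, le_max_right _ _, (subset_tsupport _).trans (hR.trans ?_)⟩
    exact Metric.closedBall_subset_closedBall (le_max_left _ _)
  set B : ℕ := ⌈R / s₀ + 3⌉₊ with hB
  refine ⟨Finset.univ ×ˢ Fintype.piFinset (fun _ : Fin 4 => Finset.Icc (-(B : ℤ)) B), ?_⟩
  intro s hs y hy p hp
  have hs' : 0 < s := hs₀.trans_le hs
  -- ‖y‖ ≤ 2 s
  have hynorm : ‖y‖ ≤ 2 * s := by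
    rw [EuclideanSpace.norm_eq]
    have hcoord : ∀ i, ‖y i‖ ^ 2 ≤ s ^ 2 := by
      intro i
      rw [Real.norm_eq_abs, sq_abs]
      have h0 := (hy i).1; have h1 := (hy i).2
      nlinarith
    have hsum : ∑ i : Fin 4, ‖y i‖ ^ 2 ≤ (2 * s) ^ 2 := by
      calc ∑ i : Fin 4, ‖y i‖ ^ 2 ≤ ∑ _i : Fin 4, s ^ 2 := Finset.sum_le_sum fun i _ => hcoord i
        _ = (2 * s) ^ 2 := by simp; ring
    calc Real.sqrt (∑ i : Fin 4, ‖y i‖ ^ 2) ≤ Real.sqrt ((2 * s) ^ 2) := Real.sqrt_le_sqrt hsum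
      _ = 2 * s := Real.sqrt_sq (by linarith)
  have key : ∀ w : EuclideanSpace ℝ (Fin 4), ‖w‖ = ‖s • (siteToE p.2 + centreOffset p.1)‖ → b (w - y) = 0 := by
    intro w hw
    by_contra hne
    refine hp ?_
    simp only [Finset.mem_product, Finset.mem_univ, true_and, Fintype.mem_piFinset, Finset.mem_Icc]
    intro i
    have h := abs_coord_le_of_ne_zero hR hs' (norm_centreOffset_le_one p.1) p.2 y w hw hne i
    have hmono : (R + ‖y‖) / s + 1 ≤ R / s₀ + 3 := by
      have h1 : (R + ‖y‖) / s ≤ (R + 2 * s) / s := div_le_div_of_nonneg_right (by linarith) hs'.le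
      have h2 : (R + 2 * s) / s = R / s + 2 := by field_simp
      have h3 : R / s ≤ R / s₀ := div_le_div_of_nonneg_left hR0 hs₀ hs
      linarith
    have h1 : |(p.2 i : ℝ)| ≤ (B : ℝ) := (h.trans hmono).trans (Nat.le_ceil _)
    have h2 : |p.2 i| ≤ (B : ℤ) := by exact_mod_cast h1
    exact abs_le.1 h2
  refine ⟨?_, ?_⟩
  · by_cases hq : p.1 ∈ Q ∧ p.1.1 < p.1.2
    · rw [if_pos hq]; exact key _ rfl
    · rw [if_neg hq]
  · by_cases hq : p.1 ∈ Q ∧ p.1.1 < p.1.2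
    · rw [if_pos hq]; exact key _ (LinearIsometryEquiv.norm_map _ _)
    · rw [if_neg hq]

/-! ## 4. Clause (ii) of `RPOnsetFloor` -/

/-- **Clause (ii) of `RPOnsetFloor` (stmt-QuantumFields-23138), for every compact `G`, lattice datum `r`, compactly
supported profile `b` and level `ε > 0`**: for every `s₀ > 0` there is `β₁` such that for `β ≥ β₁`, every odd-torus limit
state `μ`, every resolution `s ≥ s₀`, orientation `q` and offset `y ∈ [0,s]⁴`, the RP square of the single-orientation atom is
`< ε` (statement = the crux's clause with its `let`s expanded). [folklore] -/
theorem onsetVanishes (r : LatticeRep G) (b : SchwartzMap (EuclideanSpace ℝ (Fin 4)) ℝ)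
    (hb : HasCompactSupport (b : EuclideanSpace ℝ (Fin 4) → ℝ)) {ε : ℝ} (hε : 0 < ε) :
    ∀ s₀ : ℝ, 0 < s₀ → ∃ β₁ : ℝ, ∀ β : ℝ, β₁ ≤ β → ∀ μ ∈ oddTorusLimitPoints r β,
      ∀ s : ℝ, s₀ ≤ s → ∀ (q : Fin 4 × Fin 4) (y : EuclideanSpace ℝ (Fin 4)), (∀ i, 0 ≤ y i ∧ y i ≤ s) →
        (∑' pp : ((Fin 4 × Fin 4) × (Fin 4 → ℤ)) × ((Fin 4 × Fin 4) × (Fin 4 → ℤ)),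
          (if pp.1.1 ∈ ({q} : Finset (Fin 4 × Fin 4)) ∧ pp.1.1.1 < pp.1.1.2 then
              b (timeReflection 4 (s • (siteToE pp.1.2 + centreOffset pp.1.1)) - y) else 0) *
            (if pp.2.1 ∈ ({q} : Finset (Fin 4 × Fin 4)) ∧ pp.2.1.1 < pp.2.1.2 then
              b (s • (siteToE pp.2.2 + centreOffset pp.2.1) - y) else 0) *
            stateMomentStr G r μ 2 ![pp.1.1, pp.2.1] ![pp.1.2, pp.2.2]) < ε := by
  intro s₀ hs₀
  haveI : SecondCountableTopology G := r.secondCountableTopology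
  haveI : T2Space G := r.t2Space
  -- the bound on `b`
  obtain ⟨Bb, hBb⟩ : ∃ C : ℝ, ∀ u, ‖(b : EuclideanSpace ℝ (Fin 4) → ℝ) u‖ ≤ C := hb.exists_bound_of_continuous b.continuous
  have hBb0 : 0 ≤ Bb := (norm_nonneg _).trans (hBb 0)
  -- one support box for all orientations, all `s ≥ s₀`, all offsets in the box
  obtain ⟨S, hS⟩ := exists_support_box_unif (b : EuclideanSpace ℝ (Fin 4) → ℝ) hb Finset.univ hs₀
  -- the moment budget
  set K : ℝ := (S.card : ℝ) * Bb with hK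
  have hK0 : 0 ≤ K := by positivity
  set η : ℝ := ε / (2 * ((r.N : ℝ) ^ 2 + 1) * (K ^ 2 + 1)) with hη
  have hη0 : 0 < η := by positivity
  obtain ⟨β₀, hβ₀⟩ := integral_deficit_le r hη0
  refine ⟨β₀, fun β hβ μ hμ s hs q y hy => ?_⟩
  have hμ' := mem_infiniteVolumeLimitPoints_of_mem_oddTorusLimitPoints r hμ
  obtain ⟨-, -, hprob, -⟩ := id hμ'
  -- the weights restricted to the singleton orientation set vanish off `S` too
  have hSq : ∀ p : (Fin 4 × Fin 4) × Site 4, p ∉ S →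
      (if p.1 ∈ ({q} : Finset (Fin 4 × Fin 4)) ∧ p.1.1 < p.1.2 then b (s • (siteToE p.2 + centreOffset p.1) - y) else 0) = 0 ∧
      (if p.1 ∈ ({q} : Finset (Fin 4 × Fin 4)) ∧ p.1.1 < p.1.2 then
        b (timeReflection 4 (s • (siteToE p.2 + centreOffset p.1)) - y) else 0) = 0 := by
    intro p hp
    have h := hS s hs y hy p hp
    simp only [Finset.mem_univ, true_and] at h
    refine ⟨?_, ?_⟩
    · by_cases hc : p.1 ∈ ({q} : Finset (Fin 4 × Fin 4)) ∧ p.1.1 < p.1.2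
      · rw [if_pos hc]; have h1 := h.1; rw [if_pos hc.2] at h1; exact h1
      · rw [if_neg hc]
    · by_cases hc : p.1 ∈ ({q} : Finset (Fin 4 × Fin 4)) ∧ p.1.1 < p.1.2
      · rw [if_pos hc]; have h2 := h.2; rw [if_pos hc.2] at h2; exact h2
      · rw [if_neg hc]
  -- weight bounds
  have hwt : ∀ p : (Fin 4 × Fin 4) × Site 4,
      |(if p.1 ∈ ({q} : Finset (Fin 4 × Fin 4)) ∧ p.1.1 < p.1.2 then b (s • (siteToE p.2 + centreOffset p.1) - y) else 0)| ≤ Bb := by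
    intro p
    split_ifs
    · rw [← Real.norm_eq_abs]; exact hBb _
    · rw [abs_zero]; exact hBb0
  have hwr : ∀ p : (Fin 4 × Fin 4) × Site 4,
      |(if p.1 ∈ ({q} : Finset (Fin 4 × Fin 4)) ∧ p.1.1 < p.1.2 then
        b (timeReflection 4 (s • (siteToE p.2 + centreOffset p.1)) - y) else 0)| ≤ Bb := by
    intro p
    split_ifs
    · rw [← Real.norm_eq_abs]; exact hBb _
    · rw [abs_zero]; exact hBb0
  -- the moment bound, for the pairs that matter (both orientations `= q`, valid)
  have hmom : ∀ pp : ((Fin 4 × Fin 4) × Site 4) × ((Fin 4 × Fin 4) × Site 4),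
      |(if pp.1.1 ∈ ({q} : Finset (Fin 4 × Fin 4)) ∧ pp.1.1.1 < pp.1.1.2 then
          b (timeReflection 4 (s • (siteToE pp.1.2 + centreOffset pp.1.1)) - y) else 0) *
        (if pp.2.1 ∈ ({q} : Finset (Fin 4 × Fin 4)) ∧ pp.2.1.1 < pp.2.1.2 then
          b (s • (siteToE pp.2.2 + centreOffset pp.2.1) - y) else 0) *
        stateMomentStr G r μ 2 ![pp.1.1, pp.2.1] ![pp.1.2, pp.2.2]| ≤ Bb * Bb * (2 * r.N * (r.N * η)) := by
    intro pp
    by_cases h1 : pp.1.1 ∈ ({q} : Finset (Fin 4 × Fin 4)) ∧ pp.1.1.1 < pp.1.1.2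
    · by_cases h2 : pp.2.1 ∈ ({q} : Finset (Fin 4 × Fin 4)) ∧ pp.2.1.1 < pp.2.1.2
      · have hM := abs_stateMomentStr_two_le r μ pp.1.1 pp.2.1 pp.1.2 pp.2.2
          (hβ₀ β hβ μ hμ pp.1.1 h1.2 pp.1.2) (hβ₀ β hβ μ hμ pp.2.1 h2.2 pp.2.2)
        rw [abs_mul, abs_mul]
        exact mul_le_mul (mul_le_mul (hwr pp.1) (hwt pp.2) (abs_nonneg _) hBb0) hM (abs_nonneg _) (by positivity)
      · rw [if_neg h2, mul_zero, zero_mul, abs_zero]; positivity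
    · rw [if_neg h1, zero_mul, zero_mul, abs_zero]; positivity
  -- the series is a finite sum over `S × S`
  rw [tsum_eq_sum (s := S ×ˢ S) (fun pp hpp => by
    rw [Finset.mem_product, not_and_or] at hpp
    rcases hpp with h | h
    · rw [(hSq _ h).2, zero_mul, zero_mul]
    · rw [(hSq _ h).1, mul_zero, zero_mul])]
  calc ∑ pp ∈ S ×ˢ S, _ ≤ ∑ pp ∈ S ×ˢ S, Bb * Bb * (2 * r.N * (r.N * η)) :=
        (Finset.sum_le_sum fun pp _ => (le_abs_self _).trans (hmom pp))
    _ = (S.card : ℝ) ^ 2 * Bb ^ 2 * (2 * r.N ^ 2 * η) := by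
        rw [Finset.sum_const, Finset.card_product, nsmul_eq_mul]; push_cast; ring
    _ = K ^ 2 * (2 * r.N ^ 2 * η) := by rw [hK]; ring
    _ < ε := by
        have hden : 0 < ((r.N : ℝ) ^ 2 + 1) * (K ^ 2 + 1) := by positivity
        have hrew : K ^ 2 * (2 * (r.N : ℝ) ^ 2 * η) = ε * ((K ^ 2 * (r.N : ℝ) ^ 2) / (((r.N : ℝ) ^ 2 + 1) * (K ^ 2 + 1))) := by
          rw [hη]; field_simp
        rw [hrew]
        refine mul_lt_of_lt_one_right hε ((div_lt_one hden).mpr ?_)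
        nlinarith [sq_nonneg K, sq_nonneg (r.N : ℝ)]

end Summit.QuantumFields.YangMills.Theorems.OnsetSkewLawGlue

end
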